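import Summits.QuantumFields.YangMills.Theorems.BalabanUVNodesN09ReducedDoorNumericsLedger

/-!
# NODE N09 [B12] — `hres` AND `huniq` WITHOUT THE SECOND RADIUS: the hierarchical [B11] binders of N09's doors from the LEVEL-WISE slots + the DOMAIN threshold alone — the effective
# regularity of the background of record of an `ν.ε₀`-regular datum is `B₃·ν.ε₀` ((8) at the member), so FILE 1's two-radii road runs at the radius pair `(εbg, B₃ν.ε₀)` for ANY record,
# one background radius (`θ.ν.εreg = θ.εbg`, road B) included: letters `1 ≤ B₃`, `2B₃²·ν.ε₀ ≤ εbg ≤ a₀`, (53) at `B₃ν.ε₀`, `2B₃ν.ε₀ ≤ a₁`, `0 < ν.ε₀ ≤ a₁`, and for `huniq` the nesting letter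
# `2B₃ ≤ L²` (print's price) — NO `ν.εreg`, NO `hreg8`, NO (53) at `εbg`

Cell `pub-ymgap` (YM-PLAN Track A, node N09 of 28), width seat `pub-ymgap-dag-n09-w1` (generation 7), FILE 4 — sequel of FILE 1 `…N09HierarchyBindersOfLevelwiseThm1` (p640069) and
FILE 3 `…N09ReducedDoorNumericsLedger` (this seat): helper of K1⁹ `StabilityBRunRowsAtRecordR13SepCoPHV` = stmt-QuantumFields-27364 (`--supports`, `--as helper`, count-neutral).
[I] = [Balaban1987RG1] (CMP 109), [B7] = [Balaban1985Averaging] (CMP 98), [B11] = [Balaban1985Variational] (CMP 102).  Imports FILE 3 (hence FILE 1, this seat's g2 FILES 3∕5 and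
dag-n21-c's junction ∕ (53) files).  THEOREMS ONLY (0 `def`, 0 `instance`, 0 `notation`, 0 `sorry`).

WHY.  FILE 1 §4 read the (8)-membership of the level-`(j+1)` minimiser at the RECORD's second radius `ν.εreg` (`hreg8 : U_k^{(εbg)}(V) ∈ bgReg_k(ν.εreg)`, then `2B₃·ν.εreg ≤ εbg`) and
therefore does NOT fire at a ONE-RADIUS record `ν.εreg = εbg` — exactly the regime of ROAD B (dag-n09-w2 g5's `…RegularityTowerOfLocalRoute[AlphaFree]`, `heq : θ.ν.εreg = θ.εbg`,
which consumes FILE 1's `huniq_of_h11` but must still DISPLAY `hres`).  The second radius is not needed: for a datum `V ∈ domAlt_k` (`|V(∂p) − 1| < ν.ε₀`) N07's Theorem-1 slot AT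
OBJECTS + ₈a's row at the member `(K, k)` give `U_k^{(εbg)}(V) ∈ bgReg_k(B₃·ν.ε₀)` (dag-n21-c `plaqSmall_Uk_of_thm1_objects` at `δ := ν.ε₀`; this seat's g2 FILE 3 weakened this to
`bgReg_k(ν.εreg)` under `B₃ν.ε₀ ≤ ν.εreg`) — so FILE 1's pointwise §4 lemma runs VERBATIM at the numerics `ν♭ := {ν with εreg := B₃·ν.ε₀}` (a term, not a record edition: the lemma reads
`ν` through `ν.εreg` only, and `domAltOfRecord` reads `ν.ε₀` only, `domAltOfRecord ν♭ = domAltOfRecord ν` by `rfl`).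
* §1 `hregEff_of_thm1Objects_of_ukRows` — the EFFECTIVE (8)-membership `U_k^{(εbg)}(V) ∈ bgReg_k(B₃ν.ε₀)` on `domAlt_k`, `k ≤ K` (`0 < ν.ε₀ ≤ a₁`, `B₃ν.ε₀ ≤ εbg ≤ a₀`).
* §2 ★★★ `hres_of_thm1Objects_of_ukRows_of_domainThreshold` — `∀ k ≤ K, HRestrict εbg K k (domAlt_k)` from `hT1`, `hUk` (every member), `hsol`, and the letters `0 < B₃`, `0 < ν.ε₀ ≤ a₁`,
  (53) at `B₃ν.ε₀` (`C₀(d)·B₃ν.ε₀ ≤ ⅓`, `2B₃ν.ε₀ ≤ c′₂`), `2B₃ν.ε₀ ≤ a₁`, `1 ≤ B₃`, `2B₃²·ν.ε₀ ≤ εbg ≤ a₀` — NO `ν.εreg`, NO `hreg8`; fires at `ν.εreg = εbg`.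
* §3 ★★ `huniq_of_h11_of_domainThreshold` ∕ `hsolH_of_hsol_of_domainThreshold` — FILE 3's `εreg`-side nesting at `ν♭`: `huniq` from the level-wise `h11` + §1's inputs + (53) at `B₃ν.ε₀` +
  the nesting letter `2B₃ν.ε₀ ≤ ν.ε₀·L²` (i.e. **`2B₃ ≤ L²`**, print's price — FILE 3 `two_mul_B₃_le_L_sq_of_letters`); NO (53) at `εbg`, no `L ≥ 2B₃` surcharge.
* §4 ★★ `hres_huniq_of_thm1Objects_of_ukRows_of_h11_of_domainThreshold` — both at once; ★ `domainThreshold_numerics_inhabited` — A6: for `0 < a₀`, `0 < a₁`, `½ ≤ B₃`, `2B₃ ≤ L²` the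
  letter set of §2–§3 is inhabited (`ν.ε₀ := min(a₁, a₀∕(2B₃²), 1∕(3C₀B₃), c′₂∕(2B₃), a₁∕(2B₃))`, `εbg := 2B₃²ν.ε₀`), uniformly in `K`.
CONSUMER NOTE (dag-n09-w2 g5 road B, `heq : θ.ν.εreg = θ.εbg`): `hres := hres_of_thm1Objects_of_ukRows_of_domainThreshold θ.ν θ.εbg a₀ a₁ B₃ P.K (hT1 P) (hUk P) (fun k hk V hV => (h11 P k hk V hV).1) …`
— the letters are in `θ.ν.ε₀` and `θ.εbg` only.

HONEST FRAMING — what this is NOT.  Count-neutral kernel bookkeeping BY NAME (FILE 1's order theory at an instantiated numerics term); [B11] Theorem 1 enters ONLY as the displayed level-wise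
`h11`∕`hsol` and N07's object slots `hT1`∕`hUk` (levels `k ≥ 1` proved nowhere in the tree) — NOTHING of Bałaban's asserted; NO carrier of record re-pointed (`ν♭` is a local term inside
proofs, never a record); `hreg` ∕ N09 NOT discharged; conjunct 1 (Lemma 4) ∕ FLAG №7 untouched; K0⁷ ∕ K1⁹ ∕ K3⁸ NOT closed; counts unmoved (typed 28∕28 · discharged 5∕28); no summit statement
is proved by this seat; one finite four-torus programme at fixed `ε = L^{−K}` per run — R4 closes the conditional rung `BalabanLadder.UV` only; NOT continuum ∕ ℝ⁴ ∕ infinite volume ∕ OS; the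
Yang–Mills mass gap (Clay) is NOT proved by any of this.
-/

noncomputable section

namespace Summit.QuantumFields.YangMills.BalabanUVNodes.N09HierarchyBindersOfDomainThreshold

open Literature.MathematicalPhysics.QuantumFieldTheory.Balaban1983to89
open Literature.MathematicalPhysics.QuantumFieldTheory.Balaban1983to89.T4Continuum (T4Family)
open Literature.MathematicalPhysics.QuantumFieldTheory.Balaban1983to89.Node00
open Literature.MathematicalPhysics.QuantumFieldTheory.Balaban1983to89.ExpMeanLog (deltaSU deltaSU_pos)
open Literature.MathematicalPhysics.QuantumFieldTheory.Balaban1983to89.B12GaugeOrbits021 (OrbitRel)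
open Summit.QuantumFields.YangMills.BalabanUVNodes.N09HierarchyBindersOfLevelwiseThm1 (hsolH_hreg8H_at_of_thm1Objects_of_ukRows hres_of_hsolH_of_hreg8H)
open Summit.QuantumFields.YangMills.BalabanUVNodes.N09ReducedDoorNumericsLedger (iterUk_succ_mem_domAlt_of_reg8)
open Summit.QuantumFields.YangMills.Theorems.N21RegularityTransferJunction (plaqSmall_Uk_of_thm1_objects)

variable {F : T4Family} {N : ℕ} [NeZero N]

/-! ## §1  The effective (8)-membership of the background of record at the domain threshold -/

/-- **THE EFFECTIVE (8)-MEMBERSHIP**: on the small-field domain `domAlt_k` (`|V(∂p) − 1| < ν.ε₀`) the radius-`εbg` background of record is `B₃ν.ε₀`-regular, `U_k^{(εbg)}(V) ∈ bgReg_k(B₃·ν.ε₀)`,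
for every member `(K, k)`, `k ≤ K`, at which N07's Theorem-1 slot `hT1` and ₈a's row `hUk` hold at objects (dag-n21-c `plaqSmall_Uk_of_thm1_objects` at `δ := ν.ε₀`; `0 < ν.ε₀ ≤ a₁`,
`B₃ν.ε₀ ≤ εbg ≤ a₀`).  This seat's g2 FILE 3 `hreg8_of_thm1Objects_of_ukRows` is its weakening to `bgReg_k(ν.εreg)` under `B₃ν.ε₀ ≤ ν.εreg`.  CONDITIONAL on the two displayed slots.
[cite: Balaban1985Variational, Thm 1 (8) p.279; Balaban1987RG1, (1.1)–(1.2) p.260 and p.259] -/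
theorem hregEff_of_thm1Objects_of_ukRows (ν : Stage7Numerics) (εbg a₀ a₁ B₃ : ℝ) (K : ℕ)
    (hT1 : ∀ k, k ≤ K → ∀ ε₁ : ℝ, 0 < ε₁ → ε₁ ≤ a₁ → ∀ V : GaugeField (F.P K) k (SU N), PlaqSmall ε₁ V →
      (∃ U : GaugeField (F.P K) 0 (SU N), IsBackground (avOfRecord F N K) {U | InUkClassB11 F N K k (B₃ * ε₁) U} k V U) ∧
      (∀ ε₀ : ℝ, B₃ * ε₁ ≤ ε₀ → ε₀ ≤ a₀ → ∀ U U' : GaugeField (F.P K) 0 (SU N),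
          IsBackground (avOfRecord F N K) {U | InUkClassB11 F N K k (B₃ * ε₁) U} k V U →
          IsBackground (avOfRecord F N K) {U | InUkClassB11 F N K k ε₀ U} k V U' → InUkClassB11 F N K k ε₀ U ∧ OrbitRel k U U'))
    (hUk : ∀ k, k ≤ K → ∀ (V : GaugeField (F.P K) k (SU N)) (δ : ℝ), 0 < δ → δ ≤ a₁ → B₃ * δ ≤ εbg → PlaqSmall δ V →
      UkExists F N K k εbg V ∧ InUkClassB11 F N K k εbg (Uk F N K k εbg V))
    (hε₀ : 0 < ν.ε₀) (hε₀a : ν.ε₀ ≤ a₁) (hlo : B₃ * ν.ε₀ ≤ εbg) (hhi : εbg ≤ a₀) :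
    ∀ k, k ≤ K → ∀ V ∈ domAltOfRecord F N ν K k, Uk F N K k εbg V ∈ bgReg F N K k (B₃ * ν.ε₀) := by
  intro k hk V hV
  rw [mem_bgReg_iff]
  exact plaqSmall_Uk_of_thm1_objects (hT1 k hk) (hUk k hk) hhi hε₀ hε₀a hlo ((mem_domAltOfRecord_iff F N ν K k V).1 hV)

/-! ## §2  `hres` from the level-wise slots + the domain threshold — no second radius -/

/-- ★★★ **`hres` WITHOUT THE SECOND RADIUS.**  [I] (1.1)'s restriction property `HRestrict εbg K k (domAlt_k)`, `k ≤ K`, from N07's Theorem-1 slot AT OBJECTS `hT1` and ₈a's rows `hUk`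
at every member, the level-wise solvability `hsol` on the domains (₈a's row G₈a-1 at `δ := ν.ε₀`, or `h11`.1), and letters in the DOMAIN threshold `ν.ε₀` and the background radius `εbg`
ONLY: `1 ≤ B₃`, `0 < ν.ε₀ ≤ a₁`, (53) at `B₃ν.ε₀` (`C₀(d)·B₃ν.ε₀ ≤ ⅓`, `2B₃ν.ε₀ ≤ c′₂`), `2B₃ν.ε₀ ≤ a₁`, `2B₃²·ν.ε₀ ≤ εbg ≤ a₀` — FILE 1's `hsolH_hreg8H_at_of_thm1Objects_of_ukRows` at the
numerics term `{ν with εreg := B₃·ν.ε₀}` fed by §1, then FILE 1's uniqueness-free `hres_of_hsolH_of_hreg8H`.  Fires at one-radius records (`ν.εreg = εbg`, road B) and at two-radii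
records alike; NO `hreg8`.  CONDITIONAL on the displayed slots; nothing of Bałaban's asserted; N09 NOT discharged.
[cite: Balaban1987RG1, (1.1)–(1.2) p.260 and p.259; Balaban1985Variational, Thm 1 (6) and (8) p.279; Balaban1985Averaging, Prop. 2 (53) p.26] -/
theorem hres_of_thm1Objects_of_ukRows_of_domainThreshold (ν : Stage7Numerics) (εbg a₀ a₁ B₃ : ℝ) (K : ℕ)
    (hT1 : ∀ k, k ≤ K → ∀ ε₁ : ℝ, 0 < ε₁ → ε₁ ≤ a₁ → ∀ V : GaugeField (F.P K) k (SU N), PlaqSmall ε₁ V →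
      (∃ U : GaugeField (F.P K) 0 (SU N), IsBackground (avOfRecord F N K) {U | InUkClassB11 F N K k (B₃ * ε₁) U} k V U) ∧
      (∀ ε₀ : ℝ, B₃ * ε₁ ≤ ε₀ → ε₀ ≤ a₀ → ∀ U U' : GaugeField (F.P K) 0 (SU N),
          IsBackground (avOfRecord F N K) {U | InUkClassB11 F N K k (B₃ * ε₁) U} k V U →
          IsBackground (avOfRecord F N K) {U | InUkClassB11 F N K k ε₀ U} k V U' → InUkClassB11 F N K k ε₀ U ∧ OrbitRel k U U'))
    (hUk : ∀ k, k ≤ K → ∀ (V : GaugeField (F.P K) k (SU N)) (δ : ℝ), 0 < δ → δ ≤ a₁ → B₃ * δ ≤ εbg → PlaqSmall δ V →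
      UkExists F N K k εbg V ∧ InUkClassB11 F N K k εbg (Uk F N K k εbg V))
    (hsol : ∀ k, k ≤ K → ∀ V ∈ domAltOfRecord F N ν K k, UkExists F N K k εbg V)
    (hB₃ : 1 ≤ B₃) (hε₀ : 0 < ν.ε₀) (hε₀a : ν.ε₀ ≤ a₁)
    (hq3 : (143 * (((((F.P K).d + 4 : ℕ) : ℝ)) ^ 2 / 4) ^ 2) * (B₃ * ν.ε₀) ≤ 1 / 3)
    (hq2 : 2 * (B₃ * ν.ε₀) ≤ 2 * deltaSU (Fin N) / ((((F.P K).d + 4) * (F.P K).L : ℕ) : ℝ) ^ 2)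
    (hqa : 2 * (B₃ * ν.ε₀) ≤ a₁) (hB : 2 * B₃ * (B₃ * ν.ε₀) ≤ εbg) (hhi : εbg ≤ a₀) :
    ∀ k, k ≤ K → HRestrict F N εbg K k (domAltOfRecord F N ν K k) := by
  have hB0 : 0 < B₃ := by linarith
  have hlo : B₃ * ν.ε₀ ≤ εbg := by nlinarith [mul_pos hB0 hε₀]
  have hε : 0 ≤ εbg := by nlinarith [mul_pos hB0 hε₀]
  have hEff := hregEff_of_thm1Objects_of_ukRows ν εbg a₀ a₁ B₃ K hT1 hUk hε₀ hε₀a hlo hhi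
  have H : ∀ k, k ≤ K → ∀ V ∈ domAltOfRecord F N ν K k, ∀ j < k,
      UkExists F N K (j + 1) εbg (Averaging.iter (avOfRecord F N K) (j + 1) (Uk F N K k εbg V)) ∧
        Uk F N K (j + 1) εbg (Averaging.iter (avOfRecord F N K) (j + 1) (Uk F N K k εbg V)) ∈ bgReg F N K k εbg :=
    fun k hk V hV j hj => hsolH_hreg8H_at_of_thm1Objects_of_ukRows ({ ν with εreg := B₃ * ν.ε₀ } : Stage7Numerics) hj
      (hT1 (j + 1) (by omega)) (hUk (j + 1) (by omega)) (hEff k hk V hV) hB0.le (mul_pos hB0 hε₀) hq3 hq2 hqa hB hhi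
  exact hres_of_hsolH_of_hreg8H hε K (fun k => domAltOfRecord F N ν K k) hsol (fun k hk V hV j hj => (H k hk V hV j hj).1)
    (fun k hk V hV j hj => (H k hk V hV j hj).2)

/-! ## §3  `huniq` from the level-wise `h11` + the domain threshold — nesting at `B₃ν.ε₀`, price `2B₃ ≤ L²` -/

/-- ★★ **`hsolH` WITHOUT THE SECOND RADIUS**: level-wise solvability at the averaged data `Ū^{j+1}(U_k V)` from `hsol` and §1's inputs, the nesting read at the effective class
`bgReg_k(B₃ν.ε₀)` (FILE 3 `iterUk_succ_mem_domAlt_of_reg8` at `{ν with εreg := B₃ν.ε₀}`): letters `0 < B₃`, `0 < ν.ε₀ ≤ a₁`, `B₃ν.ε₀ ≤ εbg ≤ a₀`, (53) at `B₃ν.ε₀`, and the nesting letter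
`2B₃ν.ε₀ ≤ ν.ε₀·L²` (⇔ `2B₃ ≤ L²`). [cite: Balaban1985Averaging, Prop. 2 (53) p.26; Balaban1985Variational, Thm 1 (8) p.279] -/
theorem hsolH_of_hsol_of_domainThreshold (ν : Stage7Numerics) (εbg a₀ a₁ B₃ : ℝ) (K : ℕ)
    (hT1 : ∀ k, k ≤ K → ∀ ε₁ : ℝ, 0 < ε₁ → ε₁ ≤ a₁ → ∀ V : GaugeField (F.P K) k (SU N), PlaqSmall ε₁ V →
      (∃ U : GaugeField (F.P K) 0 (SU N), IsBackground (avOfRecord F N K) {U | InUkClassB11 F N K k (B₃ * ε₁) U} k V U) ∧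
      (∀ ε₀ : ℝ, B₃ * ε₁ ≤ ε₀ → ε₀ ≤ a₀ → ∀ U U' : GaugeField (F.P K) 0 (SU N),
          IsBackground (avOfRecord F N K) {U | InUkClassB11 F N K k (B₃ * ε₁) U} k V U →
          IsBackground (avOfRecord F N K) {U | InUkClassB11 F N K k ε₀ U} k V U' → InUkClassB11 F N K k ε₀ U ∧ OrbitRel k U U'))
    (hUk : ∀ k, k ≤ K → ∀ (V : GaugeField (F.P K) k (SU N)) (δ : ℝ), 0 < δ → δ ≤ a₁ → B₃ * δ ≤ εbg → PlaqSmall δ V →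
      UkExists F N K k εbg V ∧ InUkClassB11 F N K k εbg (Uk F N K k εbg V))
    (hsol : ∀ k, k ≤ K → ∀ V ∈ domAltOfRecord F N ν K k, UkExists F N K k εbg V)
    (hB₃ : 0 < B₃) (hε₀ : 0 < ν.ε₀) (hε₀a : ν.ε₀ ≤ a₁) (hlo : B₃ * ν.ε₀ ≤ εbg) (hhi : εbg ≤ a₀)
    (hq3 : (143 * (((((F.P K).d + 4 : ℕ) : ℝ)) ^ 2 / 4) ^ 2) * (B₃ * ν.ε₀) ≤ 1 / 3)
    (hq2 : 2 * (B₃ * ν.ε₀) ≤ 2 * deltaSU (Fin N) / ((((F.P K).d + 4) * (F.P K).L : ℕ) : ℝ) ^ 2)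
    (hq0 : 2 * (B₃ * ν.ε₀) ≤ ν.ε₀ * ((F.P K).L : ℝ) ^ 2) :
    ∀ k, k ≤ K → ∀ V ∈ domAltOfRecord F N ν K k, ∀ j < k,
      UkExists F N K (j + 1) εbg (Averaging.iter (avOfRecord F N K) (j + 1) (Uk F N K k εbg V)) := by
  have hEff := hregEff_of_thm1Objects_of_ukRows ν εbg a₀ a₁ B₃ K hT1 hUk hε₀ hε₀a hlo hhi
  intro k hk V hV j hj
  have hmem := iterUk_succ_mem_domAlt_of_reg8 (F := F) (N := N) ({ ν with εreg := B₃ * ν.ε₀ } : Stage7Numerics) (εbg := εbg)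
    (mul_pos hB₃ hε₀) hq3 hq2 hq0 hV (hsol k hk V hV) (hEff k hk V hV) hj
  exact hsol (j + 1) (by omega) _ hmem

/-- ★★ **`huniq` WITHOUT THE SECOND RADIUS**: the doors' hierarchical uniqueness binder from the LEVEL-WISE `h11` + N07's object slots (for §1's effective membership) + letters in `ν.ε₀`, `εbg`
only: `0 < B₃`, `0 < ν.ε₀ ≤ a₁`, `B₃ν.ε₀ ≤ εbg ≤ a₀`, (53) at `B₃ν.ε₀`, and the nesting letter `2B₃ν.ε₀ ≤ ν.ε₀·L²` — i.e. **`2B₃ ≤ L²`**, print's price (FILE 3 `two_mul_B₃_le_L_sq_of_letters`);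
NO (53) at `εbg`, NO `L ≥ 2B₃` surcharge, NO `ν.εreg`.  CONDITIONAL on `h11` (N07) and the object slots; nothing of Bałaban's asserted.
[cite: Balaban1985Variational, Thm 1 (6) and (8) p.279; Balaban1985Averaging, Prop. 2 (53) p.26; Balaban1987RG1, (1.1)–(1.2) p.260] -/
theorem huniq_of_h11_of_domainThreshold (ν : Stage7Numerics) (εbg a₀ a₁ B₃ : ℝ) (K : ℕ)
    (hT1 : ∀ k, k ≤ K → ∀ ε₁ : ℝ, 0 < ε₁ → ε₁ ≤ a₁ → ∀ V : GaugeField (F.P K) k (SU N), PlaqSmall ε₁ V →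
      (∃ U : GaugeField (F.P K) 0 (SU N), IsBackground (avOfRecord F N K) {U | InUkClassB11 F N K k (B₃ * ε₁) U} k V U) ∧
      (∀ ε₀ : ℝ, B₃ * ε₁ ≤ ε₀ → ε₀ ≤ a₀ → ∀ U U' : GaugeField (F.P K) 0 (SU N),
          IsBackground (avOfRecord F N K) {U | InUkClassB11 F N K k (B₃ * ε₁) U} k V U →
          IsBackground (avOfRecord F N K) {U | InUkClassB11 F N K k ε₀ U} k V U' → InUkClassB11 F N K k ε₀ U ∧ OrbitRel k U U'))
    (hUk : ∀ k, k ≤ K → ∀ (V : GaugeField (F.P K) k (SU N)) (δ : ℝ), 0 < δ → δ ≤ a₁ → B₃ * δ ≤ εbg → PlaqSmall δ V →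
      UkExists F N K k εbg V ∧ InUkClassB11 F N K k εbg (Uk F N K k εbg V))
    (h11 : ∀ k, k ≤ K → ∀ V ∈ domAltOfRecord F N ν K k, UkExists F N K k εbg V ∧ UniqueUkOrbit F N K k εbg V)
    (hB₃ : 0 < B₃) (hε₀ : 0 < ν.ε₀) (hε₀a : ν.ε₀ ≤ a₁) (hlo : B₃ * ν.ε₀ ≤ εbg) (hhi : εbg ≤ a₀)
    (hq3 : (143 * (((((F.P K).d + 4 : ℕ) : ℝ)) ^ 2 / 4) ^ 2) * (B₃ * ν.ε₀) ≤ 1 / 3)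
    (hq2 : 2 * (B₃ * ν.ε₀) ≤ 2 * deltaSU (Fin N) / ((((F.P K).d + 4) * (F.P K).L : ℕ) : ℝ) ^ 2)
    (hq0 : 2 * (B₃ * ν.ε₀) ≤ ν.ε₀ * ((F.P K).L : ℝ) ^ 2) :
    ∀ k, k ≤ K → ∀ V ∈ domAltOfRecord F N ν K k, ∀ j < k,
      UniqueUkOrbit F N K (j + 1) εbg (Averaging.iter (avOfRecord F N K) (j + 1) (Uk F N K k εbg V)) := by
  have hEff := hregEff_of_thm1Objects_of_ukRows ν εbg a₀ a₁ B₃ K hT1 hUk hε₀ hε₀a hlo hhi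
  intro k hk V hV j hj
  have hmem := iterUk_succ_mem_domAlt_of_reg8 (F := F) (N := N) ({ ν with εreg := B₃ * ν.ε₀ } : Stage7Numerics) (εbg := εbg)
    (mul_pos hB₃ hε₀) hq3 hq2 hq0 hV (h11 k hk V hV).1 (hEff k hk V hV) hj
  exact (h11 (j + 1) (by omega) _ hmem).2

/-! ## §4  Both at once; A6 -/

/-- ★★ **`hres ∧ huniq` FROM {level-wise `h11`, N07's object slots `hT1`∕`hUk`} + LETTERS IN `ν.ε₀`, `εbg`, `L` ONLY** (`1 ≤ B₃`, `0 < ν.ε₀ ≤ a₁`, (53) at `B₃ν.ε₀`, `2B₃ν.ε₀ ≤ a₁`,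
`2B₃²ν.ε₀ ≤ εbg ≤ a₀`, `2B₃ν.ε₀ ≤ ν.ε₀L²`) — §2 + §3; the package a one-radius road-B door (`θ.ν.εreg = θ.εbg`) can consume for BOTH hierarchical binders.  CONDITIONAL; nothing of Bałaban's
asserted; N09 NOT discharged. [cite: Balaban1985Variational, Thm 1 (6) and (8) p.279; Balaban1987RG1, (1.1)–(1.2) p.260; Balaban1985Averaging, Prop. 2 (53) p.26] -/
theorem hres_huniq_of_thm1Objects_of_ukRows_of_h11_of_domainThreshold (ν : Stage7Numerics) (εbg a₀ a₁ B₃ : ℝ) (K : ℕ)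
    (hT1 : ∀ k, k ≤ K → ∀ ε₁ : ℝ, 0 < ε₁ → ε₁ ≤ a₁ → ∀ V : GaugeField (F.P K) k (SU N), PlaqSmall ε₁ V →
      (∃ U : GaugeField (F.P K) 0 (SU N), IsBackground (avOfRecord F N K) {U | InUkClassB11 F N K k (B₃ * ε₁) U} k V U) ∧
      (∀ ε₀ : ℝ, B₃ * ε₁ ≤ ε₀ → ε₀ ≤ a₀ → ∀ U U' : GaugeField (F.P K) 0 (SU N),
          IsBackground (avOfRecord F N K) {U | InUkClassB11 F N K k (B₃ * ε₁) U} k V U →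
          IsBackground (avOfRecord F N K) {U | InUkClassB11 F N K k ε₀ U} k V U' → InUkClassB11 F N K k ε₀ U ∧ OrbitRel k U U'))
    (hUk : ∀ k, k ≤ K → ∀ (V : GaugeField (F.P K) k (SU N)) (δ : ℝ), 0 < δ → δ ≤ a₁ → B₃ * δ ≤ εbg → PlaqSmall δ V →
      UkExists F N K k εbg V ∧ InUkClassB11 F N K k εbg (Uk F N K k εbg V))
    (h11 : ∀ k, k ≤ K → ∀ V ∈ domAltOfRecord F N ν K k, UkExists F N K k εbg V ∧ UniqueUkOrbit F N K k εbg V)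
    (hB₃ : 1 ≤ B₃) (hε₀ : 0 < ν.ε₀) (hε₀a : ν.ε₀ ≤ a₁)
    (hq3 : (143 * (((((F.P K).d + 4 : ℕ) : ℝ)) ^ 2 / 4) ^ 2) * (B₃ * ν.ε₀) ≤ 1 / 3)
    (hq2 : 2 * (B₃ * ν.ε₀) ≤ 2 * deltaSU (Fin N) / ((((F.P K).d + 4) * (F.P K).L : ℕ) : ℝ) ^ 2)
    (hqa : 2 * (B₃ * ν.ε₀) ≤ a₁) (hB : 2 * B₃ * (B₃ * ν.ε₀) ≤ εbg) (hhi : εbg ≤ a₀) (hq0 : 2 * (B₃ * ν.ε₀) ≤ ν.ε₀ * ((F.P K).L : ℝ) ^ 2) :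
    (∀ k, k ≤ K → HRestrict F N εbg K k (domAltOfRecord F N ν K k)) ∧
      (∀ k, k ≤ K → ∀ V ∈ domAltOfRecord F N ν K k, ∀ j < k,
        UniqueUkOrbit F N K (j + 1) εbg (Averaging.iter (avOfRecord F N K) (j + 1) (Uk F N K k εbg V))) := by
  have hB0 : 0 < B₃ := by linarith
  have hlo : B₃ * ν.ε₀ ≤ εbg := by nlinarith [mul_pos hB0 hε₀]
  exact ⟨hres_of_thm1Objects_of_ukRows_of_domainThreshold ν εbg a₀ a₁ B₃ K hT1 hUk (fun k hk V hV => (h11 k hk V hV).1) hB₃ hε₀ hε₀a hq3 hq2 hqa hB hhi,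
    huniq_of_h11_of_domainThreshold ν εbg a₀ a₁ B₃ K hT1 hUk h11 hB0 hε₀ hε₀a hlo hhi hq3 hq2 hq0⟩

/-- ★ **A6 — THE DOMAIN-THRESHOLD LETTER SET IS INHABITED UNDER PRINT's `2B₃ ≤ L²`** (`0 < a₀`, `0 < a₁`, `½ ≤ B₃`): there are `ε₀ εbg` with `0 < ε₀ ≤ a₁`, (53) at `B₃ε₀`, `2B₃ε₀ ≤ a₁`,
`2B₃²ε₀ ≤ εbg ≤ a₀`, `2B₃ε₀ ≤ ε₀L²`, uniformly in `K`.  Witness: `r := min(a₀∕(2B₃), 1∕(3C₀), c′₂∕2, a₁∕2)` (the effective radius `B₃ε₀`), `ε₀ := r∕B₃`, `εbg := 2B₃r`.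
[cite: Balaban1985Variational, Thm 1 p.279 (bookkeeping); Balaban1985Averaging, Prop. 2 (52)–(53) p.26; Balaban1987RG1, (0.1) p.251] -/
theorem domainThreshold_numerics_inhabited (F : T4Family) (N : ℕ) [NeZero N] {a₀ a₁ B₃ : ℝ} (ha₀ : 0 < a₀) (ha₁ : 0 < a₁) (hB₃ : 1 / 2 ≤ B₃)
    (hL : 2 * B₃ ≤ (F.L : ℝ) ^ 2) :
    ∃ ε₀ εbg : ℝ, 0 < ε₀ ∧ ε₀ ≤ a₁ ∧
      (∀ K : ℕ, (143 * (((((F.P K).d + 4 : ℕ) : ℝ)) ^ 2 / 4) ^ 2) * (B₃ * ε₀) ≤ 1 / 3) ∧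
      (∀ K : ℕ, 2 * (B₃ * ε₀) ≤ 2 * deltaSU (Fin N) / ((((F.P K).d + 4) * (F.P K).L : ℕ) : ℝ) ^ 2) ∧
      2 * (B₃ * ε₀) ≤ a₁ ∧ 2 * B₃ * (B₃ * ε₀) ≤ εbg ∧ εbg ≤ a₀ ∧
      (∀ K : ℕ, 2 * (B₃ * ε₀) ≤ ε₀ * ((F.P K).L : ℝ) ^ 2) := by
  have hB0 : 0 < B₃ := by linarith
  have hL0 : (0 : ℝ) < F.L := by exact_mod_cast F.hL.2.le.trans_lt' (by norm_num)
  set C₀ : ℝ := 143 * ((((4 + 4 : ℕ) : ℝ)) ^ 2 / 4) ^ 2 with hC₀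
  set c₂ : ℝ := 2 * deltaSU (Fin N) / ((((4 + 4) * F.L : ℕ) : ℝ)) ^ 2 with hc₂
  have hC₀pos : 0 < C₀ := by positivity
  have hLn : 0 < F.L := by have := F.hL.2; omega
  have hc₂pos : 0 < c₂ := by
    have hδ : 0 < deltaSU (Fin N) := deltaSU_pos
    have : (0 : ℝ) < (((4 + 4) * F.L : ℕ) : ℝ) := Nat.cast_pos.2 (Nat.mul_pos (by norm_num) hLn)
    positivity
  set r : ℝ := min (a₀ / (2 * B₃)) (min (1 / (3 * C₀)) (min (c₂ / 2) (a₁ / 2))) with hr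
  have hrpos : 0 < r := lt_min (by positivity) (lt_min (by positivity) (lt_min (by positivity) (by positivity)))
  have h1 : r ≤ a₀ / (2 * B₃) := min_le_left _ _
  have h2 : r ≤ 1 / (3 * C₀) := (min_le_right _ _).trans (min_le_left _ _)
  have h3 : r ≤ c₂ / 2 := (min_le_right _ _).trans ((min_le_right _ _).trans (min_le_left _ _))
  have h4 : r ≤ a₁ / 2 := (min_le_right _ _).trans ((min_le_right _ _).trans (min_le_right _ _))
  have hBr : B₃ * (r / B₃) = r := mul_div_cancel₀ _ hB0.ne'
  refine ⟨r / B₃, 2 * B₃ * r, by positivity, ?_, ?_, ?_, ?_, ?_, ?_, ?_⟩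
  · rw [div_le_iff₀ hB0]; nlinarith
  · intro K
    simp only [T4Family.P_d]
    rw [hBr]
    calc C₀ * r ≤ C₀ * (1 / (3 * C₀)) := mul_le_mul_of_nonneg_left h2 hC₀pos.le
      _ = 1 / 3 := by field_simp
  · intro K
    simp only [T4Family.P_d, T4Family.P_L]
    rw [hBr]
    linarith
  · rw [hBr]; linarith
  · rw [hBr]
  · calc 2 * B₃ * r ≤ 2 * B₃ * (a₀ / (2 * B₃)) := mul_le_mul_of_nonneg_left h1 (by positivity)
      _ = a₀ := by field_simp
  · intro K
    simp only [T4Family.P_L]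
    rw [hBr, show r / B₃ * (F.L : ℝ) ^ 2 = r * ((F.L : ℝ) ^ 2 / B₃) by ring]
    have h2le : (2 : ℝ) ≤ (F.L : ℝ) ^ 2 / B₃ := by rw [le_div_iff₀ hB0]; linarith
    calc 2 * r = r * 2 := mul_comm _ _
      _ ≤ r * ((F.L : ℝ) ^ 2 / B₃) := mul_le_mul_of_nonneg_left h2le hrpos.le

end Summit.QuantumFields.YangMills.BalabanUVNodes.N09HierarchyBindersOfDomainThreshold

end
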